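import Summits.HodgeConjecture.HodgeConjecture.Theorems.Ring2WeilCoverageTypeNormSignPrincipal
import Summits.HodgeConjecture.HodgeConjecture.Theorems.Ring2WeilCoverageCyclotomicSignaturesG4
import Summits.HodgeConjecture.HodgeConjecture.Theorems.Ring2WeilCoverageCMTypeSetOddPositions
import HarnessLib

/-!
# Weil-type family coverage — THE NORM-SIGN LAW AT THE `g = 4` CYCLOTOMIC LEVELS `15, 20, 24`: on every census row
# `(ℚ(ζ_M), K)` of the octic cyclotomic fields the `ι`-compatible polarisation types `(ϖ₀)` carried by the
# `K`-balanced (Weil-type) CM fourfolds `ℂ^Φ/Φ(ℤ[ζ_M])` are EXACTLY the real generators `ϖ₀ ∈ 𝓞 ℚ(ζ_M)⁺` with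
# `N(ϖ₀) < 0` (the two NO rows at `15`) resp. `N(ϖ₀) > 0` (the six YES rows at `20`, `24`)

research route conditional on HC_CM; not a corollary; Q11.4-sentence-2 already refuted in dim ≥ 3.

Ring 2, WEIL-TYPE FAMILY-COVERAGE CENSUS (`HOME/WEIL-FAMILY-COVERAGE.md` `## b01`, block b01.46 «the cyclotomic CM
FOURFOLDS of Weil type»; owner ring2-b01), part 77 of the `Ring2WeilCoverage*` series: the `g = 4` level file of parts
55/55b (`…TypeNormSign`, `…TypeNormSignPrincipal`: for any CM field, under THEOREM L (i)/(ii), «type `(ϖ₀)` occurs on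
`ℂ^Φ/D(𝔪)`» ⟺ («principal» ⟺ `N_{K⁺/ℚ}(ϖ₀) > 0`)), companion of parts 56/56b/56c (`g = 6, 10, 12, 8`).  At
`M ∈ {15, 20, 24}` THEOREM L (i) (`norm_realUnits_pos_M`, part 67: every unit of `ℤ[ζ_M]⁺` has norm `+1`) and
THEOREM L (ii) (`exists_units_sign_eq_M`, part 75: every even sign pattern is a unit pattern) are hypothesis-free tree
theorems, and the principal verdict of a `K`-balanced `Φ` is the residue bit `n₋(M, K) = #{t ∈ N_K : 2t < M} (mod 2)`
(part 5′ `card_inter_nodd_mod_two_eq`, THEOREM F): odd at `(15, ℚ(√−15))`, `(15, ℚ(√−3))`, even at the six rows of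
`20, 24`.  Hence, for EVERY real `ϖ₀ ∈ 𝓞 K⁺ ∖ 0` at once:

* NO rows (`(15, ℚ(√−15))`, `(15, ℚ(√−3))`): **type `(ϖ₀)` occurs ⟺ `N_{K⁺/ℚ}(ϖ₀) < 0`** — the Weil-type
  `ℤ[ζ₁₅]`-fourfolds carry `ι`-compatible polarisations of exactly the degrees `|N(ϖ₀)|` with `N(ϖ₀) < 0`;
* YES rows (`(20, ℚ(i))`, `(20, ℚ(√−5))`, `(24, ℚ(i))`, `(24, ℚ(√−2))`, `(24, ℚ(√−3))`, `(24, ℚ(√−6))`):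
  **type `(ϖ₀)` occurs ⟺ `N_{K⁺/ℚ}(ϖ₀) > 0`**;
* every level, EVERY CM type `Φ` (balanced or not): `N(ϖ₀) < 0` ⇒ exactly one of «principal», «type `(ϖ₀)`»;
  `N(ϖ₀) > 0` ⇒ both or neither.

Since `h(ℚ(ζ_M)) = 1` at these levels [Was97 Thm. 11.1], `h(ℚ(ζ_M)⁺) = 1`, every type `𝔣₀ ⊆ 𝓞 K⁺` is principal and
`ℂ^Φ/Φ(ℤ[ζ_M])` is THE fourfold with multiplication by `ℤ[ζ_M]` of type `Φ` — so these rows list ALL `ι`-compatible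
polarisation types of all Weil-type CM fourfolds with multiplication by `ℤ[ζ₁₅]`, `ℤ[ζ₂₀]`, `ℤ[ζ₂₄]` (S-pencil remark;
the kernel statements quantify over principal types `(ϖ₀)` on the principal torus).  At `16` everything occurs (part
76 `exists_pos_isOfType_sixteen`).

Theorems: `exists_type_iff_norm_neg_fifteen_sqrt_neg_fifteen`, `…_fifteen_sqrt_neg_three`,
`xor_principal_type_fifteen_of_norm_neg`, `exists_type_iff_principal_fifteen_of_norm_pos`;
`exists_type_iff_norm_pos_twenty_sqrt_neg_one/_neg_five`, `xor_principal_type_twenty_of_norm_neg`,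
`exists_type_iff_principal_twenty_of_norm_pos`; `exists_type_iff_norm_pos_twentyFour_sqrt_neg_one/_two/_three/_six`,
`xor_principal_type_twentyFour_of_norm_neg`, `exists_type_iff_principal_twentyFour_of_norm_pos`.

HONEST FRAMING: torus-level statements about Shimura's divisors of type `(K; Φ; 𝔣₀)` [Sh98 §14.3 Prop. 4–5] on
`ℂ^Φ/Φ(ℤ[ζ_M])` and norms of elements of `ℚ(ζ_M)⁺`; nothing here is a statement about Hodge classes, `W_K`, general
members or HC; `HC_CM` is used nowhere.  No `def`, no named fact, no `sorry`.

References: [cite: Shimura1998, §14.3 Prop. 4–5, pp. 103–104]; [cite: Washington1997, Thm. 11.1]; census b01.42 / b01.46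
(seat-derived).
-/

noncomputable section

open Polynomial NumberField Complex Finset
open scoped Real nonZeroDivisors

namespace Summit.HodgeConjecture.Ring2WeilCoverage.TypeNormSignLevelsG4

open Literature.AlgebraicGeometry.Motives (CMType)
open Literature.AlgebraicGeometry.HodgeTheory (IsCMTypeSet)
open Literature.AlgebraicGeometry.ComplexMultiplication.CyclotomicCMType (isCMTypeSet_residueFilter)
open Literature.NumberTheory.ComplexMultiplication
open Summit.HodgeConjecture.Ring2WeilCoverage.TypeNormSign
open Summit.HodgeConjecture.Ring2WeilCoverage.CyclotomicDifferent (xi_ne_zero isOfType_one_xi_top)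
open Summit.HodgeConjecture.Ring2WeilCoverage.CyclotomicPrincipalObstruction (complexConj_xi)
open Summit.HodgeConjecture.Ring2WeilCoverage.CMTypeSetOddPositions (card_inter_nodd_mod_two_eq)
open Summit.HodgeConjecture.Ring2WeilCoverage.RealUnitNormAllLevels
  (norm_realUnits_pos_fifteen norm_realUnits_pos_twenty norm_realUnits_pos_twentyFour)
open Summit.HodgeConjecture.Ring2WeilCoverage.CyclotomicSignaturesG4
  (exists_units_sign_eq_fifteen exists_units_sign_eq_twenty exists_units_sign_eq_twentyFour)

variable {K : Type} [Field K] [NumberField K] {ζ : K}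

/-- `𝐞(t) = exp(2πi t/n) ∈ ℂ` (`ZMod.toCircle`). -/
local notation3 (prettyPrint := false) "𝐞 " t:max => ((ZMod.toCircle t : Circle) : ℂ)

/-! ### Level `15` (`g = 4`; both rows NO) -/

section Level15

/-- the residue set `S_Φ` read at level `15`. -/
local notation3 (prettyPrint := false) "SΦ15[" Φ "," z "]" =>
  (Finset.univ.filter fun t : ZMod 15 => ∃ σ ∈ (Φ : CMType K).1, σ (z : K) = 𝐞 t)

open scoped Classical in
/-- **CENSUS ROW `(ℚ(ζ₁₅), ℚ(√−15))` — THE TYPE SPECTRUM (a NO row).**  For every CM type `Φ` of `ℚ(ζ₁₅)` balanced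
for `N_K = {7, 11, 13, 14}` (Weil signature `(2,2)` on `K = ℚ(√−15)`) and EVERY real integer `ϖ₀ ∈ 𝓞 K⁺ ∖ 0`
(`K⁺ = ℚ(ζ₁₅)⁺`): the principal CM torus `ℂ^Φ/Φ(ℤ[ζ₁₅])` — a Weil-type CM fourfold — carries a `Φ`-positive divisor
`X_ζ′` of type `(K; Φ; (ϖ₀))` (an `ι`-compatible polarisation of degree `|N_{K⁺/ℚ}(ϖ₀)|`) **iff `N_{K⁺/ℚ}(ϖ₀) < 0`**
(part 55b `exists_type_span_iff_norm_neg_of_odd` + THEOREM L (i)/(ii) at `15` + `|S_Φ ∩ N_odd| ≡ n₋ = 1`).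
research route conditional on HC_CM; not a corollary; Q11.4-sentence-2 already refuted in dim ≥ 3. [cite: Shimura1998, §14.3 Prop. 4–5, pp. 103–104] -/
theorem exists_type_iff_norm_neg_fifteen_sqrt_neg_fifteen [IsCMField K] [IsCyclotomicExtension {15} ℚ K]
    (hζ : IsPrimitiveRoot ζ 15) (Φ : CMType K)
    (hbal : 2 * (SΦ15[Φ, ζ] ∩ ({7, 11, 13, 14} : Finset (ZMod 15))).card = (SΦ15[Φ, ζ]).card)
    {ϖ₀ : 𝓞 (maximalRealSubfield K)} (hϖ0 : ϖ₀ ≠ 0) :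
    (∃ ζ' : K, IsCMField.complexConj K ζ' = -ζ' ∧ (∀ φ : Φ.1, 0 < (φ.1 ζ').im) ∧
        CMTypeLattice.IsOfType (1 : (FractionalIdeal (𝓞 K)⁰ K)ˣ) ζ' (Ideal.span {ϖ₀})) ↔
      Algebra.norm ℚ ((ϖ₀ : maximalRealSubfield K)) < 0 := by
  have hg : Nat.totient 15 = 2 * (3 + 1) := by decide
  refine exists_type_span_iff_norm_neg_of_odd hζ hg Φ hϖ0 (norm_realUnits_pos_fifteen hζ)
    (exists_units_sign_eq_fifteen hζ Φ) ?_
  have hS := isCMTypeSet_residueFilter hζ Φ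
  have hNK : IsCMTypeSet 15 ({7, 11, 13, 14} : Finset (ZMod 15)) := by decide
  have h := card_inter_nodd_mod_two_eq (m := 15) (by norm_num) hS hNK hbal
  have hn : ((({7, 11, 13, 14} : Finset (ZMod 15))).filter fun t : ZMod 15 => 2 * t.val < 15).card % 2 = 1 := by
    decide
  rw [hn] at h
  exact Nat.odd_iff.mpr h

open scoped Classical in
/-- **CENSUS ROW `(ℚ(ζ₁₅), ℚ(√−3))` — THE TYPE SPECTRUM (a NO row).**  For every CM type `Φ` of `ℚ(ζ₁₅)` balanced
for `N_K = {2, 8, 11, 14}` (`K = ℚ(√−3)`) and EVERY real integer `ϖ₀ ∈ 𝓞 K⁺ ∖ 0`: type `(ϖ₀)` occurs on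
`ℂ^Φ/Φ(ℤ[ζ₁₅])` **iff `N_{K⁺/ℚ}(ϖ₀) < 0`** (`n₋ = 1`).
research route conditional on HC_CM; not a corollary; Q11.4-sentence-2 already refuted in dim ≥ 3. [cite: Shimura1998, §14.3 Prop. 4–5, pp. 103–104] -/
theorem exists_type_iff_norm_neg_fifteen_sqrt_neg_three [IsCMField K] [IsCyclotomicExtension {15} ℚ K]
    (hζ : IsPrimitiveRoot ζ 15) (Φ : CMType K)
    (hbal : 2 * (SΦ15[Φ, ζ] ∩ ({2, 8, 11, 14} : Finset (ZMod 15))).card = (SΦ15[Φ, ζ]).card)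
    {ϖ₀ : 𝓞 (maximalRealSubfield K)} (hϖ0 : ϖ₀ ≠ 0) :
    (∃ ζ' : K, IsCMField.complexConj K ζ' = -ζ' ∧ (∀ φ : Φ.1, 0 < (φ.1 ζ').im) ∧
        CMTypeLattice.IsOfType (1 : (FractionalIdeal (𝓞 K)⁰ K)ˣ) ζ' (Ideal.span {ϖ₀})) ↔
      Algebra.norm ℚ ((ϖ₀ : maximalRealSubfield K)) < 0 := by
  have hg : Nat.totient 15 = 2 * (3 + 1) := by decide
  refine exists_type_span_iff_norm_neg_of_odd hζ hg Φ hϖ0 (norm_realUnits_pos_fifteen hζ)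
    (exists_units_sign_eq_fifteen hζ Φ) ?_
  have hS := isCMTypeSet_residueFilter hζ Φ
  have hNK : IsCMTypeSet 15 ({2, 8, 11, 14} : Finset (ZMod 15)) := by decide
  have h := card_inter_nodd_mod_two_eq (m := 15) (by norm_num) hS hNK hbal
  have hn : ((({2, 8, 11, 14} : Finset (ZMod 15))).filter fun t : ZMod 15 => 2 * t.val < 15).card % 2 = 1 := by
    decide
  rw [hn] at h
  exact Nat.odd_iff.mpr h

/-- **DICHOTOMY AT LEVEL `15` for EVERY real generator of NEGATIVE norm**: for every one of the `16` CM types `Φ` of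
`ℚ(ζ₁₅)` and every `ϖ₀ ∈ 𝓞 K⁺` with `N_{K⁺/ℚ}(ϖ₀) < 0`, the torus `ℂ^Φ/Φ(ℤ[ζ₁₅])` carries EITHER an `ι`-compatible
principal polarisation OR a `Φ`-positive divisor of type `(ϖ₀)`, NEVER BOTH (part 55b `xor_principal_span_of_norm_neg`
+ THEOREM L (i)/(ii) at `15`).
research route conditional on HC_CM; not a corollary; Q11.4-sentence-2 already refuted in dim ≥ 3. [cite: Shimura1998, §14.3 Prop. 4–5, pp. 103–104] -/
theorem xor_principal_type_fifteen_of_norm_neg [IsCMField K] [IsCyclotomicExtension {15} ℚ K]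
    (hζ : IsPrimitiveRoot ζ 15) (Φ : CMType K) {ϖ₀ : 𝓞 (maximalRealSubfield K)}
    (hneg : Algebra.norm ℚ ((ϖ₀ : maximalRealSubfield K)) < 0) :
    Xor (∃ ζ' : K, IsCMField.complexConj K ζ' = -ζ' ∧ (∀ φ : Φ.1, 0 < (φ.1 ζ').im) ∧
          CMTypeLattice.IsOfType (1 : (FractionalIdeal (𝓞 K)⁰ K)ˣ) ζ' ⊤)
      (∃ ζ' : K, IsCMField.complexConj K ζ' = -ζ' ∧ (∀ φ : Φ.1, 0 < (φ.1 ζ').im) ∧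
        CMTypeLattice.IsOfType (1 : (FractionalIdeal (𝓞 K)⁰ K)ˣ) ζ' (Ideal.span {ϖ₀})) := by
  have hg : Nat.totient 15 = 2 * (3 + 1) := by decide
  exact xor_principal_span_of_norm_neg Φ 1 (complexConj_xi hζ hg) (xi_ne_zero hζ 3) (isOfType_one_xi_top hζ 3) hneg
    (norm_realUnits_pos_fifteen hζ) (exists_units_sign_eq_fifteen hζ Φ)

/-- **POSITIVE norm at level `15`**: for every CM type `Φ` of `ℚ(ζ₁₅)` and every `ϖ₀ ∈ 𝓞 K⁺` with
`N_{K⁺/ℚ}(ϖ₀) > 0`, type `(ϖ₀)` occurs on `ℂ^Φ/Φ(ℤ[ζ₁₅])` iff an `ι`-compatible principal polarisation does (part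
55b `exists_pos_isOfType_span_iff_principal_of_norm_pos` + THEOREM L (i)/(ii) at `15`); so on the two (NO) Weil rows
no type of positive norm occurs at all.
research route conditional on HC_CM; not a corollary; Q11.4-sentence-2 already refuted in dim ≥ 3. [cite: Shimura1998, §14.3 Prop. 4–5, pp. 103–104] -/
theorem exists_type_iff_principal_fifteen_of_norm_pos [IsCMField K] [IsCyclotomicExtension {15} ℚ K]
    (hζ : IsPrimitiveRoot ζ 15) (Φ : CMType K) {ϖ₀ : 𝓞 (maximalRealSubfield K)}
    (hpos : 0 < Algebra.norm ℚ ((ϖ₀ : maximalRealSubfield K))) :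
    (∃ ζ' : K, IsCMField.complexConj K ζ' = -ζ' ∧ (∀ φ : Φ.1, 0 < (φ.1 ζ').im) ∧
        CMTypeLattice.IsOfType (1 : (FractionalIdeal (𝓞 K)⁰ K)ˣ) ζ' (Ideal.span {ϖ₀})) ↔
      (∃ ζ' : K, IsCMField.complexConj K ζ' = -ζ' ∧ (∀ φ : Φ.1, 0 < (φ.1 ζ').im) ∧
          CMTypeLattice.IsOfType (1 : (FractionalIdeal (𝓞 K)⁰ K)ˣ) ζ' ⊤) := by
  have hg : Nat.totient 15 = 2 * (3 + 1) := by decide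
  exact exists_pos_isOfType_span_iff_principal_of_norm_pos Φ 1 (complexConj_xi hζ hg) (xi_ne_zero hζ 3)
    (isOfType_one_xi_top hζ 3) hpos (norm_realUnits_pos_fifteen hζ) (exists_units_sign_eq_fifteen hζ Φ)

end Level15

/-! ### Level `20` (`g = 4`; both rows YES) -/

section Level20

/-- the residue set `S_Φ` read at level `20`. -/
local notation3 (prettyPrint := false) "SΦ20[" Φ "," z "]" =>
  (Finset.univ.filter fun t : ZMod 20 => ∃ σ ∈ (Φ : CMType K).1, σ (z : K) = 𝐞 t)

open scoped Classical in
/-- **CENSUS ROW `(ℚ(ζ₂₀), ℚ(i))` — THE TYPE SPECTRUM (a YES row).**  For every CM type `Φ` of `ℚ(ζ₂₀)` balanced for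
`N_K = {3, 7, 11, 19}` (`K = ℚ(i)`) and EVERY real integer `ϖ₀ ∈ 𝓞 K⁺ ∖ 0`: `ℂ^Φ/Φ(ℤ[ζ₂₀])` carries a `Φ`-positive
divisor of type `(K; Φ; (ϖ₀))` **iff `N_{K⁺/ℚ}(ϖ₀) > 0`** (part 55b `exists_type_span_iff_norm_pos_of_even` + THEOREM L
(i)/(ii) at `20` + `|S_Φ ∩ N_odd| ≡ n₋ = 2`).
research route conditional on HC_CM; not a corollary; Q11.4-sentence-2 already refuted in dim ≥ 3. [cite: Shimura1998, §14.3 Prop. 4–5, pp. 103–104] -/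
theorem exists_type_iff_norm_pos_twenty_sqrt_neg_one [IsCMField K] [IsCyclotomicExtension {20} ℚ K]
    (hζ : IsPrimitiveRoot ζ 20) (Φ : CMType K)
    (hbal : 2 * (SΦ20[Φ, ζ] ∩ ({3, 7, 11, 19} : Finset (ZMod 20))).card = (SΦ20[Φ, ζ]).card)
    {ϖ₀ : 𝓞 (maximalRealSubfield K)} (hϖ0 : ϖ₀ ≠ 0) :
    (∃ ζ' : K, IsCMField.complexConj K ζ' = -ζ' ∧ (∀ φ : Φ.1, 0 < (φ.1 ζ').im) ∧
        CMTypeLattice.IsOfType (1 : (FractionalIdeal (𝓞 K)⁰ K)ˣ) ζ' (Ideal.span {ϖ₀})) ↔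
      0 < Algebra.norm ℚ ((ϖ₀ : maximalRealSubfield K)) := by
  have hg : Nat.totient 20 = 2 * (3 + 1) := by decide
  refine exists_type_span_iff_norm_pos_of_even hζ hg Φ hϖ0 (norm_realUnits_pos_twenty hζ)
    (exists_units_sign_eq_twenty hζ Φ) ?_
  have hS := isCMTypeSet_residueFilter hζ Φ
  have hNK : IsCMTypeSet 20 ({3, 7, 11, 19} : Finset (ZMod 20)) := by decide
  have h := card_inter_nodd_mod_two_eq (m := 20) (by norm_num) hS hNK hbal
  have hn : ((({3, 7, 11, 19} : Finset (ZMod 20))).filter fun t : ZMod 20 => 2 * t.val < 20).card % 2 = 0 := by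
    decide
  rw [hn] at h
  exact Nat.even_iff.mpr h

open scoped Classical in
/-- **CENSUS ROW `(ℚ(ζ₂₀), ℚ(√−5))` — THE TYPE SPECTRUM (a YES row).**  For every CM type `Φ` of `ℚ(ζ₂₀)` balanced
for `N_K = {11, 13, 17, 19}` (`K = ℚ(√−5)`) and EVERY real integer `ϖ₀ ∈ 𝓞 K⁺ ∖ 0`: type `(ϖ₀)` occurs on
`ℂ^Φ/Φ(ℤ[ζ₂₀])` **iff `N_{K⁺/ℚ}(ϖ₀) > 0`** (`n₋ = 0`).
research route conditional on HC_CM; not a corollary; Q11.4-sentence-2 already refuted in dim ≥ 3. [cite: Shimura1998, §14.3 Prop. 4–5, pp. 103–104] -/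
theorem exists_type_iff_norm_pos_twenty_sqrt_neg_five [IsCMField K] [IsCyclotomicExtension {20} ℚ K]
    (hζ : IsPrimitiveRoot ζ 20) (Φ : CMType K)
    (hbal : 2 * (SΦ20[Φ, ζ] ∩ ({11, 13, 17, 19} : Finset (ZMod 20))).card = (SΦ20[Φ, ζ]).card)
    {ϖ₀ : 𝓞 (maximalRealSubfield K)} (hϖ0 : ϖ₀ ≠ 0) :
    (∃ ζ' : K, IsCMField.complexConj K ζ' = -ζ' ∧ (∀ φ : Φ.1, 0 < (φ.1 ζ').im) ∧
        CMTypeLattice.IsOfType (1 : (FractionalIdeal (𝓞 K)⁰ K)ˣ) ζ' (Ideal.span {ϖ₀})) ↔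
      0 < Algebra.norm ℚ ((ϖ₀ : maximalRealSubfield K)) := by
  have hg : Nat.totient 20 = 2 * (3 + 1) := by decide
  refine exists_type_span_iff_norm_pos_of_even hζ hg Φ hϖ0 (norm_realUnits_pos_twenty hζ)
    (exists_units_sign_eq_twenty hζ Φ) ?_
  have hS := isCMTypeSet_residueFilter hζ Φ
  have hNK : IsCMTypeSet 20 ({11, 13, 17, 19} : Finset (ZMod 20)) := by decide
  have h := card_inter_nodd_mod_two_eq (m := 20) (by norm_num) hS hNK hbal
  have hn : ((({11, 13, 17, 19} : Finset (ZMod 20))).filter fun t : ZMod 20 => 2 * t.val < 20).card % 2 = 0 := by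
    decide
  rw [hn] at h
  exact Nat.even_iff.mpr h

/-- **DICHOTOMY AT LEVEL `20` for EVERY real generator of NEGATIVE norm** (any of the `16` CM types `Φ`): EITHER an
`ι`-compatible principal polarisation OR a `Φ`-positive divisor of type `(ϖ₀)` on `ℂ^Φ/Φ(ℤ[ζ₂₀])`, never both.
research route conditional on HC_CM; not a corollary; Q11.4-sentence-2 already refuted in dim ≥ 3. [cite: Shimura1998, §14.3 Prop. 4–5, pp. 103–104] -/
theorem xor_principal_type_twenty_of_norm_neg [IsCMField K] [IsCyclotomicExtension {20} ℚ K]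
    (hζ : IsPrimitiveRoot ζ 20) (Φ : CMType K) {ϖ₀ : 𝓞 (maximalRealSubfield K)}
    (hneg : Algebra.norm ℚ ((ϖ₀ : maximalRealSubfield K)) < 0) :
    Xor (∃ ζ' : K, IsCMField.complexConj K ζ' = -ζ' ∧ (∀ φ : Φ.1, 0 < (φ.1 ζ').im) ∧
          CMTypeLattice.IsOfType (1 : (FractionalIdeal (𝓞 K)⁰ K)ˣ) ζ' ⊤)
      (∃ ζ' : K, IsCMField.complexConj K ζ' = -ζ' ∧ (∀ φ : Φ.1, 0 < (φ.1 ζ').im) ∧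
        CMTypeLattice.IsOfType (1 : (FractionalIdeal (𝓞 K)⁰ K)ˣ) ζ' (Ideal.span {ϖ₀})) := by
  have hg : Nat.totient 20 = 2 * (3 + 1) := by decide
  exact xor_principal_span_of_norm_neg Φ 1 (complexConj_xi hζ hg) (xi_ne_zero hζ 3) (isOfType_one_xi_top hζ 3) hneg
    (norm_realUnits_pos_twenty hζ) (exists_units_sign_eq_twenty hζ Φ)

/-- **POSITIVE norm at level `20`**: type `(ϖ₀)` with `N(ϖ₀) > 0` occurs on `ℂ^Φ/Φ(ℤ[ζ₂₀])` iff an `ι`-compatible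
principal polarisation does (any `Φ`).
research route conditional on HC_CM; not a corollary; Q11.4-sentence-2 already refuted in dim ≥ 3. [cite: Shimura1998, §14.3 Prop. 4–5, pp. 103–104] -/
theorem exists_type_iff_principal_twenty_of_norm_pos [IsCMField K] [IsCyclotomicExtension {20} ℚ K]
    (hζ : IsPrimitiveRoot ζ 20) (Φ : CMType K) {ϖ₀ : 𝓞 (maximalRealSubfield K)}
    (hpos : 0 < Algebra.norm ℚ ((ϖ₀ : maximalRealSubfield K))) :
    (∃ ζ' : K, IsCMField.complexConj K ζ' = -ζ' ∧ (∀ φ : Φ.1, 0 < (φ.1 ζ').im) ∧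
        CMTypeLattice.IsOfType (1 : (FractionalIdeal (𝓞 K)⁰ K)ˣ) ζ' (Ideal.span {ϖ₀})) ↔
      (∃ ζ' : K, IsCMField.complexConj K ζ' = -ζ' ∧ (∀ φ : Φ.1, 0 < (φ.1 ζ').im) ∧
          CMTypeLattice.IsOfType (1 : (FractionalIdeal (𝓞 K)⁰ K)ˣ) ζ' ⊤) := by
  have hg : Nat.totient 20 = 2 * (3 + 1) := by decide
  exact exists_pos_isOfType_span_iff_principal_of_norm_pos Φ 1 (complexConj_xi hζ hg) (xi_ne_zero hζ 3)
    (isOfType_one_xi_top hζ 3) hpos (norm_realUnits_pos_twenty hζ) (exists_units_sign_eq_twenty hζ Φ)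

end Level20

/-! ### Level `24` (`g = 4`; all four rows YES) -/

section Level24

/-- the residue set `S_Φ` read at level `24`. -/
local notation3 (prettyPrint := false) "SΦ24[" Φ "," z "]" =>
  (Finset.univ.filter fun t : ZMod 24 => ∃ σ ∈ (Φ : CMType K).1, σ (z : K) = 𝐞 t)

open scoped Classical in
/-- **CENSUS ROW `(ℚ(ζ₂₄), ℚ(i))` — THE TYPE SPECTRUM (a YES row)**: for every CM type `Φ` of `ℚ(ζ₂₄)` balanced for
`N_K = {7, 11, 19, 23}` (`K = ℚ(i)`) and EVERY real integer `ϖ₀ ∈ 𝓞 K⁺ ∖ 0`, type `(ϖ₀)` occurs on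
`ℂ^Φ/Φ(ℤ[ζ₂₄])` **iff `N_{K⁺/ℚ}(ϖ₀) > 0`** (`n₋ = 2`).
research route conditional on HC_CM; not a corollary; Q11.4-sentence-2 already refuted in dim ≥ 3. [cite: Shimura1998, §14.3 Prop. 4–5, pp. 103–104] -/
theorem exists_type_iff_norm_pos_twentyFour_sqrt_neg_one [IsCMField K] [IsCyclotomicExtension {24} ℚ K]
    (hζ : IsPrimitiveRoot ζ 24) (Φ : CMType K)
    (hbal : 2 * (SΦ24[Φ, ζ] ∩ ({7, 11, 19, 23} : Finset (ZMod 24))).card = (SΦ24[Φ, ζ]).card)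
    {ϖ₀ : 𝓞 (maximalRealSubfield K)} (hϖ0 : ϖ₀ ≠ 0) :
    (∃ ζ' : K, IsCMField.complexConj K ζ' = -ζ' ∧ (∀ φ : Φ.1, 0 < (φ.1 ζ').im) ∧
        CMTypeLattice.IsOfType (1 : (FractionalIdeal (𝓞 K)⁰ K)ˣ) ζ' (Ideal.span {ϖ₀})) ↔
      0 < Algebra.norm ℚ ((ϖ₀ : maximalRealSubfield K)) := by
  have hg : Nat.totient 24 = 2 * (3 + 1) := by decide
  refine exists_type_span_iff_norm_pos_of_even hζ hg Φ hϖ0 (norm_realUnits_pos_twentyFour hζ)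
    (exists_units_sign_eq_twentyFour hζ Φ) ?_
  have hS := isCMTypeSet_residueFilter hζ Φ
  have hNK : IsCMTypeSet 24 ({7, 11, 19, 23} : Finset (ZMod 24)) := by decide
  have h := card_inter_nodd_mod_two_eq (m := 24) (by norm_num) hS hNK hbal
  have hn : ((({7, 11, 19, 23} : Finset (ZMod 24))).filter fun t : ZMod 24 => 2 * t.val < 24).card % 2 = 0 := by
    decide
  rw [hn] at h
  exact Nat.even_iff.mpr h

open scoped Classical in
/-- **CENSUS ROW `(ℚ(ζ₂₄), ℚ(√−2))` — THE TYPE SPECTRUM (a YES row)**: `N_K = {5, 7, 13, 23}` (`K = ℚ(√−2)`), type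
`(ϖ₀)` occurs on `ℂ^Φ/Φ(ℤ[ζ₂₄])` **iff `N_{K⁺/ℚ}(ϖ₀) > 0`** (`n₋ = 2`).
research route conditional on HC_CM; not a corollary; Q11.4-sentence-2 already refuted in dim ≥ 3. [cite: Shimura1998, §14.3 Prop. 4–5, pp. 103–104] -/
theorem exists_type_iff_norm_pos_twentyFour_sqrt_neg_two [IsCMField K] [IsCyclotomicExtension {24} ℚ K]
    (hζ : IsPrimitiveRoot ζ 24) (Φ : CMType K)
    (hbal : 2 * (SΦ24[Φ, ζ] ∩ ({5, 7, 13, 23} : Finset (ZMod 24))).card = (SΦ24[Φ, ζ]).card)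
    {ϖ₀ : 𝓞 (maximalRealSubfield K)} (hϖ0 : ϖ₀ ≠ 0) :
    (∃ ζ' : K, IsCMField.complexConj K ζ' = -ζ' ∧ (∀ φ : Φ.1, 0 < (φ.1 ζ').im) ∧
        CMTypeLattice.IsOfType (1 : (FractionalIdeal (𝓞 K)⁰ K)ˣ) ζ' (Ideal.span {ϖ₀})) ↔
      0 < Algebra.norm ℚ ((ϖ₀ : maximalRealSubfield K)) := by
  have hg : Nat.totient 24 = 2 * (3 + 1) := by decide
  refine exists_type_span_iff_norm_pos_of_even hζ hg Φ hϖ0 (norm_realUnits_pos_twentyFour hζ)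
    (exists_units_sign_eq_twentyFour hζ Φ) ?_
  have hS := isCMTypeSet_residueFilter hζ Φ
  have hNK : IsCMTypeSet 24 ({5, 7, 13, 23} : Finset (ZMod 24)) := by decide
  have h := card_inter_nodd_mod_two_eq (m := 24) (by norm_num) hS hNK hbal
  have hn : ((({5, 7, 13, 23} : Finset (ZMod 24))).filter fun t : ZMod 24 => 2 * t.val < 24).card % 2 = 0 := by
    decide
  rw [hn] at h
  exact Nat.even_iff.mpr h

open scoped Classical in
/-- **CENSUS ROW `(ℚ(ζ₂₄), ℚ(√−3))` — THE TYPE SPECTRUM (a YES row)**: `N_K = {5, 11, 17, 23}` (`K = ℚ(√−3)`), type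
`(ϖ₀)` occurs on `ℂ^Φ/Φ(ℤ[ζ₂₄])` **iff `N_{K⁺/ℚ}(ϖ₀) > 0`** (`n₋ = 2`).
research route conditional on HC_CM; not a corollary; Q11.4-sentence-2 already refuted in dim ≥ 3. [cite: Shimura1998, §14.3 Prop. 4–5, pp. 103–104] -/
theorem exists_type_iff_norm_pos_twentyFour_sqrt_neg_three [IsCMField K] [IsCyclotomicExtension {24} ℚ K]
    (hζ : IsPrimitiveRoot ζ 24) (Φ : CMType K)
    (hbal : 2 * (SΦ24[Φ, ζ] ∩ ({5, 11, 17, 23} : Finset (ZMod 24))).card = (SΦ24[Φ, ζ]).card)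
    {ϖ₀ : 𝓞 (maximalRealSubfield K)} (hϖ0 : ϖ₀ ≠ 0) :
    (∃ ζ' : K, IsCMField.complexConj K ζ' = -ζ' ∧ (∀ φ : Φ.1, 0 < (φ.1 ζ').im) ∧
        CMTypeLattice.IsOfType (1 : (FractionalIdeal (𝓞 K)⁰ K)ˣ) ζ' (Ideal.span {ϖ₀})) ↔
      0 < Algebra.norm ℚ ((ϖ₀ : maximalRealSubfield K)) := by
  have hg : Nat.totient 24 = 2 * (3 + 1) := by decide
  refine exists_type_span_iff_norm_pos_of_even hζ hg Φ hϖ0 (norm_realUnits_pos_twentyFour hζ)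
    (exists_units_sign_eq_twentyFour hζ Φ) ?_
  have hS := isCMTypeSet_residueFilter hζ Φ
  have hNK : IsCMTypeSet 24 ({5, 11, 17, 23} : Finset (ZMod 24)) := by decide
  have h := card_inter_nodd_mod_two_eq (m := 24) (by norm_num) hS hNK hbal
  have hn : ((({5, 11, 17, 23} : Finset (ZMod 24))).filter fun t : ZMod 24 => 2 * t.val < 24).card % 2 = 0 := by
    decide
  rw [hn] at h
  exact Nat.even_iff.mpr h

open scoped Classical in
/-- **CENSUS ROW `(ℚ(ζ₂₄), ℚ(√−6))` — THE TYPE SPECTRUM (a YES row)**: `N_K = {13, 17, 19, 23}` (`K = ℚ(√−6)`),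
type `(ϖ₀)` occurs on `ℂ^Φ/Φ(ℤ[ζ₂₄])` **iff `N_{K⁺/ℚ}(ϖ₀) > 0`** (`n₋ = 0`).
research route conditional on HC_CM; not a corollary; Q11.4-sentence-2 already refuted in dim ≥ 3. [cite: Shimura1998, §14.3 Prop. 4–5, pp. 103–104] -/
theorem exists_type_iff_norm_pos_twentyFour_sqrt_neg_six [IsCMField K] [IsCyclotomicExtension {24} ℚ K]
    (hζ : IsPrimitiveRoot ζ 24) (Φ : CMType K)
    (hbal : 2 * (SΦ24[Φ, ζ] ∩ ({13, 17, 19, 23} : Finset (ZMod 24))).card = (SΦ24[Φ, ζ]).card)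
    {ϖ₀ : 𝓞 (maximalRealSubfield K)} (hϖ0 : ϖ₀ ≠ 0) :
    (∃ ζ' : K, IsCMField.complexConj K ζ' = -ζ' ∧ (∀ φ : Φ.1, 0 < (φ.1 ζ').im) ∧
        CMTypeLattice.IsOfType (1 : (FractionalIdeal (𝓞 K)⁰ K)ˣ) ζ' (Ideal.span {ϖ₀})) ↔
      0 < Algebra.norm ℚ ((ϖ₀ : maximalRealSubfield K)) := by
  have hg : Nat.totient 24 = 2 * (3 + 1) := by decide
  refine exists_type_span_iff_norm_pos_of_even hζ hg Φ hϖ0 (norm_realUnits_pos_twentyFour hζ)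
    (exists_units_sign_eq_twentyFour hζ Φ) ?_
  have hS := isCMTypeSet_residueFilter hζ Φ
  have hNK : IsCMTypeSet 24 ({13, 17, 19, 23} : Finset (ZMod 24)) := by decide
  have h := card_inter_nodd_mod_two_eq (m := 24) (by norm_num) hS hNK hbal
  have hn : ((({13, 17, 19, 23} : Finset (ZMod 24))).filter fun t : ZMod 24 => 2 * t.val < 24).card % 2 = 0 := by
    decide
  rw [hn] at h
  exact Nat.even_iff.mpr h

/-- **DICHOTOMY AT LEVEL `24` for EVERY real generator of NEGATIVE norm** (any of the `16` CM types `Φ`): EITHER an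
`ι`-compatible principal polarisation OR a `Φ`-positive divisor of type `(ϖ₀)` on `ℂ^Φ/Φ(ℤ[ζ₂₄])`, never both.
research route conditional on HC_CM; not a corollary; Q11.4-sentence-2 already refuted in dim ≥ 3. [cite: Shimura1998, §14.3 Prop. 4–5, pp. 103–104] -/
theorem xor_principal_type_twentyFour_of_norm_neg [IsCMField K] [IsCyclotomicExtension {24} ℚ K]
    (hζ : IsPrimitiveRoot ζ 24) (Φ : CMType K) {ϖ₀ : 𝓞 (maximalRealSubfield K)}
    (hneg : Algebra.norm ℚ ((ϖ₀ : maximalRealSubfield K)) < 0) :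
    Xor (∃ ζ' : K, IsCMField.complexConj K ζ' = -ζ' ∧ (∀ φ : Φ.1, 0 < (φ.1 ζ').im) ∧
          CMTypeLattice.IsOfType (1 : (FractionalIdeal (𝓞 K)⁰ K)ˣ) ζ' ⊤)
      (∃ ζ' : K, IsCMField.complexConj K ζ' = -ζ' ∧ (∀ φ : Φ.1, 0 < (φ.1 ζ').im) ∧
        CMTypeLattice.IsOfType (1 : (FractionalIdeal (𝓞 K)⁰ K)ˣ) ζ' (Ideal.span {ϖ₀})) := by
  have hg : Nat.totient 24 = 2 * (3 + 1) := by decide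
  exact xor_principal_span_of_norm_neg Φ 1 (complexConj_xi hζ hg) (xi_ne_zero hζ 3) (isOfType_one_xi_top hζ 3) hneg
    (norm_realUnits_pos_twentyFour hζ) (exists_units_sign_eq_twentyFour hζ Φ)

/-- **POSITIVE norm at level `24`**: type `(ϖ₀)` with `N(ϖ₀) > 0` occurs on `ℂ^Φ/Φ(ℤ[ζ₂₄])` iff an `ι`-compatible
principal polarisation does (any `Φ`).
research route conditional on HC_CM; not a corollary; Q11.4-sentence-2 already refuted in dim ≥ 3. [cite: Shimura1998, §14.3 Prop. 4–5, pp. 103–104] -/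
theorem exists_type_iff_principal_twentyFour_of_norm_pos [IsCMField K] [IsCyclotomicExtension {24} ℚ K]
    (hζ : IsPrimitiveRoot ζ 24) (Φ : CMType K) {ϖ₀ : 𝓞 (maximalRealSubfield K)}
    (hpos : 0 < Algebra.norm ℚ ((ϖ₀ : maximalRealSubfield K))) :
    (∃ ζ' : K, IsCMField.complexConj K ζ' = -ζ' ∧ (∀ φ : Φ.1, 0 < (φ.1 ζ').im) ∧
        CMTypeLattice.IsOfType (1 : (FractionalIdeal (𝓞 K)⁰ K)ˣ) ζ' (Ideal.span {ϖ₀})) ↔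
      (∃ ζ' : K, IsCMField.complexConj K ζ' = -ζ' ∧ (∀ φ : Φ.1, 0 < (φ.1 ζ').im) ∧
          CMTypeLattice.IsOfType (1 : (FractionalIdeal (𝓞 K)⁰ K)ˣ) ζ' ⊤) := by
  have hg : Nat.totient 24 = 2 * (3 + 1) := by decide
  exact exists_pos_isOfType_span_iff_principal_of_norm_pos Φ 1 (complexConj_xi hζ hg) (xi_ne_zero hζ 3)
    (isOfType_one_xi_top hζ 3) hpos (norm_realUnits_pos_twentyFour hζ) (exists_units_sign_eq_twentyFour hζ Φ)

end Level24

end Summit.HodgeConjecture.Ring2WeilCoverage.TypeNormSignLevelsG4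

end
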